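import Mathlib
import HarnessLib
import Summits.ResolutionOfSingularities.ResolutionOfSingularities.Theorems.HomologicalConductorNoZenoStageRational

/-!
# Kill test `SurfaceTermination` (stmt-ResolutionOfSingularities-16488): rationality PROPAGATES along the
# canonical `ca`-tower of a surface (Lipman (1.2) 1), no sandwich)

Route `ResolutionOfSingularities/HomologicalConductor`.  OURS (cell res-hironaka, crux chain W4.4, seat
res-L0-w44-stub-1, CHAIN v11 K44S-DESCENT (R2)(d)); nothing here is a statement of the manuscript under
review (Hironaka 2017); AI-written, weaker than expert review.

Along the canonical normalised `ca`-tower `T₀ ≤ T₁ ≤ …` of a two-dimensional affine model `A ⊆ O`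
(`Frac A = K`, `tr.deg_k K = 2`, `O` ANY valuation ring of `K` containing `k`):

* `stage_package_of_trdeg` — the local-ring package of a singular stage `T_(n+1)` in transcendence degree
  two WITHOUT a sandwich (Noetherian, normal, `Frac = K`, local, Krull dimension `2`, essentially of finite
  type over `k`), from the tree's stage facts;
* `hasRationalSingularity_of_le` — Lipman (1.2) 1) for a pair of two-dimensional normal local
  `k`-subalgebras `R ≤ T` of `K` (`Frac R = K`, `R` rational, `T` essentially of finite type);
* `hasRationalSingularity_tower_succ` — if the stage `T_(n+1)` is SINGULAR and has a RATIONAL singularity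
  (Lipman, Def. (1.1)), then `T_(n+2)` has a rational singularity: either `T_(n+2)` is regular (regular
  local rings are rational, the identity being a desingularization), or it is a two-dimensional normal
  local ring essentially of finite type over `T_(n+1)` inside `K = Frac T_(n+1)` — the localisation at a
  prime of a finitely generated `T_(n+1)`-subalgebra with a common denominator, i.e. a normal point of
  codimension two of a birational affine model of finite type — and Lipman's Proposition (1.2) 1) applies
  (tree: `hasRationalSingularity_of_isLocalization`, the same engine as the sandwich case
  `hasRationalSingularity_tower`, with the rational base `T_(n+1)` in place of the regular `R`);
* `hasRationalSingularity_tower_of_le` — hence every later stage `T_m`, `m ≥ n + 1`, has a rational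
  singularity (a regular stage is terminal: `tower_succ_eq_self_of_isRegularLocalRing`).
* `stage_package_zero_of_isIntegrallyClosed`, `hasRationalSingularity_tower_one`,
  `hasRationalSingularity_tower_of_zero` (rev 2) — the same from the BIRTH stage `T₀ = A_𝔭` when `A` is
  integrally closed: a rational normal surface germ `A_𝔭` propagates rationality to EVERY stage, the
  hypothesis form in which the descent applies to a rational surface singularity itself.

Conditional on the named fact `Lipman1969_1_2` only.  Use: the per-stage rationality input of THEOREM A
for a rational stage (`caInvertibleMinRes_of_hasRationalSingularity`) in the exceptional-prime-divisor
DESCENT for rational surface germs (the rational half of the kill test's residual (D-s)).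

References: J. Lipman, Publ. IHÉS 36 (1969), Def. (1.1), Prop. (1.2) 1) [`Lipman1969`].
-/

noncomputable section

-- single-problem summit: the doubled namespace component `ResolutionOfSingularities` is forced
set_option linter.dupNamespace false

namespace Summit.ResolutionOfSingularities.ResolutionOfSingularities.Theorems.SurfaceTermination.RationalDescent

open CategoryTheory AlgebraicGeometry TopologicalSpace IsLocalRing
open Literature.AlgebraicGeometry.Resolution
open Summit.ResolutionOfSingularities.ResolutionOfSingularities.Theorems
open Summit.ResolutionOfSingularities.ResolutionOfSingularities.Theorems.NoZeno.Birth
open Summit.ResolutionOfSingularities.ResolutionOfSingularities.Theorems.NoZeno.SandwichCluster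

variable {k K : Type} [Field k] [Field K] [Algebra k K]

/-- **Local-ring package of a singular stage, sandwich-free.**  For the canonical `ca`-tower of a finitely
generated `A ⊆ O` with `Frac A = K`, `tr.deg_k K = 2`, and a SINGULAR stage `T_(n+1)`: `T_(n+1)` is a
Noetherian, integrally closed local domain with `Frac T_(n+1) = K`, of Krull dimension `2` (a normal
local domain of dimension `≤ 1` is regular), essentially of finite type over `k`.  (The sandwich version is
`NoZeno.SandwichCluster.stage_package`; collected from the tree: `stub_towerNoetherian`,
`exists_tower_eq_loc`, `d2rc_isIntegrallyClosed_tower_succ`, `d2rc_ringKrullDim_tower_le`,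
`tn_tower_invariant`.) [folklore] -/
theorem stage_package_of_trdeg (O : ValuationSubring K) (A : Subalgebra k K)
    (hk : ∀ c : k, algebraMap k K c ∈ O) (hA : A.FG) (hfr : IsFractionRing ↥A K)
    (hAO : A.toSubring ≤ O.toSubring) (htr : Algebra.trdeg k K = 2) (n : ℕ)
    (hsing : ¬ IsRegularLocalRing ↥(tower O A (n + 1))) :
    IsNoetherianRing ↥(tower O A (n + 1)) ∧ IsIntegrallyClosed ↥(tower O A (n + 1)) ∧
      IsFractionRing ↥(tower O A (n + 1)) K ∧
      ∃ _ : IsLocalRing ↥(tower O A (n + 1)),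
        ringKrullDim ↥(tower O A (n + 1)) = 2 ∧ Algebra.EssFiniteType k ↥(tower O A (n + 1)) := by
  haveI := hfr
  haveI : IsNoetherianRing ↥(tower O A (n + 1)) := stub_towerNoetherian k K O A hk hA hfr hAO _
  haveI : IsLocalRing ↥(tower O A (n + 1)) := by
    obtain ⟨B, hBO, hTB⟩ := exists_tower_eq_loc O A hk hAO (n + 1)
    rw [hTB, loc_eq_locAt]; exact SyzygyFlattening.isLocalRing_locAt O B hBO
  haveI : IsIntegrallyClosed ↥(tower O A (n + 1)) :=
    d2rc_isIntegrallyClosed_tower_succ O A hk hA hfr hAO n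
  have hfrT : IsFractionRing ↥(tower O A (n + 1)) K :=
    isFractionRing_subalgebra_of_le A (tower O A (n + 1)) (tn_tower_invariant O A hk hA hfr hAO (n + 1)).1
  have hdimT : ringKrullDim ↥(tower O A (n + 1)) = 2 := by
    refine ringKrullDim_eq_two_of_not_le_one (d2rc_ringKrullDim_tower_le O A (n + 1) htr.le) ?_
    intro h1
    exact hsing (Literature.AlgebraicGeometry.Resolution.isRegularLocalRing_of_isIntegrallyClosed_of_ringKrullDim_le_one _ h1)
  exact ⟨inferInstance, inferInstance, hfrT, inferInstance, hdimT,
    (tn_tower_invariant O A hk hA hfr hAO (n + 1)).2.2⟩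

/-- **Lipman (1.2) 1) for a pair of local subalgebras of `K`** (ring form, no tower): `R ≤ T ⊆ K` with
`R` a two-dimensional normal Noetherian local domain with `Frac R = K` and a rational singularity, `T` a
two-dimensional normal Noetherian local domain essentially of finite type over `k` (hence over `R`):
then `T` has a rational singularity — `T` is the localisation at a prime of a finitely generated
`R`-subalgebra of `K = Frac R` with a common denominator, i.e. a normal point of codimension two of a
birational affine model of finite type over `R` (tree engine `hasRationalSingularity_of_isLocalization`).
[cite: Lipman1969, Proposition (1.2) 1) (p. 199)] -/
theorem hasRationalSingularity_of_le (h12 : Lipman1969_1_2.{0}) (R T : Subalgebra k K) (hRT : R ≤ T)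
    [IsNoetherianRing ↥R] [IsLocalRing ↥R] [IsIntegrallyClosed ↥R] [IsFractionRing ↥R K]
    (hdimR : ringKrullDim ↥R = 2) (hrat : HasRationalSingularity ↥R)
    [IsNoetherianRing ↥T] [IsLocalRing ↥T] [IsIntegrallyClosed ↥T] [Algebra.EssFiniteType k ↥T]
    (hdimT : ringKrullDim ↥T = 2) : HasRationalSingularity ↥T := by
  classical
  -- `T` as an `R`-algebra, essentially of finite type
  letI : Algebra ↥R ↥T := (Subalgebra.inclusion hRT).toRingHom.toAlgebra
  haveI : IsScalarTower k ↥R ↥T := IsScalarTower.of_algebraMap_eq fun c => rfl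
  haveI : Algebra.EssFiniteType ↥R ↥T := Algebra.EssFiniteType.of_comp k ↥R ↥T
  -- the finitely generated model `B₀` and the prime `𝔮 = 𝔪_T ∩ B₀`
  set B₀ : Subalgebra ↥R ↥T := Algebra.EssFiniteType.subalgebra ↥R ↥T with hB₀
  let 𝔮 : Ideal ↥B₀ := (maximalIdeal ↥T).comap (algebraMap ↥B₀ ↥T)
  haveI : 𝔮.IsPrime := Ideal.comap_isPrime _ _
  have hsub : Algebra.EssFiniteType.submonoid ↥R ↥T = 𝔮.primeCompl := by
    ext x
    simp only [Algebra.EssFiniteType.submonoid, Submonoid.mem_comap, IsUnit.mem_submonoid_iff,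
      Ideal.primeCompl, 𝔮]
    change _ ↔ algebraMap (↥B₀) (↥T) x ∉ maximalIdeal ↥T
    rw [IsLocalRing.mem_maximalIdeal, mem_nonunits_iff, not_not]
  haveI : IsLocalization.AtPrime ↥T 𝔮 := by
    rw [IsLocalization.AtPrime, ← hsub]; infer_instance
  -- injectivity of `R → B₀` and the common denominator
  have hcoe : ∀ a : ↥R, (((algebraMap ↥R ↥B₀ a : ↥B₀) : ↥T) : K) = (a : K) := fun a => rfl
  have hinj : Function.Injective (algebraMap ↥R ↥B₀) := by
    intro a b h
    have := congrArg (fun x : ↥B₀ => ((x : ↥T) : K)) h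
    simp only [hcoe] at this
    exact Subtype.ext this
  obtain ⟨r, hr0, hden⟩ := exists_denominator_adjoin R T hRT (Algebra.EssFiniteType.finset ↥R ↥T)
  have hB : ∀ b : ↥B₀, ∃ m : ℕ, ∃ a : ↥R,
      algebraMap ↥R ↥B₀ a = algebraMap ↥R ↥B₀ r ^ m * b := by
    intro b
    obtain ⟨m, a, h⟩ := hden b b.2
    refine ⟨m, a, Subtype.ext (Subtype.ext ?_)⟩
    rw [hcoe]
    push_cast
    rw [h]
    rfl
  exact hasRationalSingularity_of_isLocalization h12 hdimR hrat hinj r hr0 hB 𝔮 (T := ↥T) hdimT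

/-- **Rationality propagates one step up the `ca`-tower** (modulo Lipman (1.2)).  For the canonical
tower of `A ⊆ O` with `Frac A = K`, `tr.deg_k K = 2`: if the stage `T_(n+1)` is singular with a rational
singularity, then `T_(n+2)` has a rational singularity.  If `T_(n+2)` is regular this is Lipman's remark
after Def. (1.1); otherwise both stages are two-dimensional normal local domains, `T_(n+2)` essentially of
finite type, and `hasRationalSingularity_of_le` applies. [cite: Lipman1969, Proposition (1.2) 1) (p. 199)] -/
theorem hasRationalSingularity_tower_succ (h12 : Lipman1969_1_2.{0}) (O : ValuationSubring K)
    (A : Subalgebra k K) (hk : ∀ c : k, algebraMap k K c ∈ O) (hA : A.FG)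
    (hfr : IsFractionRing ↥A K) (hAO : A.toSubring ≤ O.toSubring) (htr : Algebra.trdeg k K = 2)
    (n : ℕ) (hsing : ¬ IsRegularLocalRing ↥(tower O A (n + 1)))
    (hrat : HasRationalSingularity ↥(tower O A (n + 1))) :
    HasRationalSingularity ↥(tower O A (n + 1 + 1)) := by
  by_cases hreg : IsRegularLocalRing ↥(tower O A (n + 1 + 1))
  · haveI := hreg
    exact hasRationalSingularity_of_isRegularLocalRing _
  -- the two stage packages
  obtain ⟨hRnoeth, hRnorm, hRfr, hRloc, hdimR, -⟩ := stage_package_of_trdeg O A hk hA hfr hAO htr n hsing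
  obtain ⟨hTnoeth, hTnorm, _, hTloc, hdimT, hTeft⟩ :=
    stage_package_of_trdeg O A hk hA hfr hAO htr (n + 1) hreg
  haveI := hRnoeth; haveI := hRnorm; haveI := hRfr; haveI := hRloc
  haveI := hTnoeth; haveI := hTnorm; haveI := hTloc; haveI := hTeft
  have hRT : tower O A (n + 1) ≤ tower O A (n + 1 + 1) := fun y hy =>
    d2rc_mem_tower_of_le O A (Nat.le_succ (n + 1)) hy
  exact hasRationalSingularity_of_le h12 (tower O A (n + 1)) (tower O A (n + 1 + 1)) hRT hdimR hrat hdimT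

/-- **Every later stage of a rational singular stage is rational** (modulo Lipman (1.2)): if
`T_(n+1)` is singular with a rational singularity, then `T_m` has a rational singularity for every
`m ≥ n + 1` — by `hasRationalSingularity_tower_succ` while the stages are singular, and because a regular
stage is rational and terminal (`tower_succ_eq_self_of_isRegularLocalRing`).
[cite: Lipman1969, Proposition (1.2) 1) (p. 199)] -/
theorem hasRationalSingularity_tower_of_le (h12 : Lipman1969_1_2.{0}) (O : ValuationSubring K)
    (A : Subalgebra k K) (hk : ∀ c : k, algebraMap k K c ∈ O) (hA : A.FG)
    (hfr : IsFractionRing ↥A K) (hAO : A.toSubring ≤ O.toSubring) (htr : Algebra.trdeg k K = 2)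
    (n : ℕ) (hrat : HasRationalSingularity ↥(tower O A (n + 1))) :
    ∀ m : ℕ, n + 1 ≤ m → HasRationalSingularity ↥(tower O A m) := by
  intro m hm
  induction m, hm using Nat.le_induction with
  | base => exact hrat
  | succ m hm ih =>
    by_cases hreg : IsRegularLocalRing ↥(tower O A m)
    · rw [tower_succ_eq_self_of_isRegularLocalRing O A hk hfr hAO m hreg]
      exact ih
    · obtain ⟨j, rfl⟩ : ∃ j, m = j + 1 := ⟨m - 1, by omega⟩
      exact hasRationalSingularity_tower_succ h12 O A hk hA hfr hAO htr j hreg ih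

/-! ## From the birth stage: a rational (normal) germ `T₀ = A_𝔭` propagates to every stage -/

/-- **The package of a singular NORMAL birth stage.**  If `A` is integrally closed (so that the birth
stage `T₀ = loc O A = A_𝔭`, `𝔭` the centre of `O`, is a normal local domain) and `T₀` is singular
(`tr.deg_k K = 2`), then `T₀` is a Noetherian integrally closed local domain with `Frac T₀ = K`, of Krull
dimension `2`, essentially of finite type over `k`. [folklore] -/
theorem stage_package_zero_of_isIntegrallyClosed (O : ValuationSubring K) (A : Subalgebra k K)
    (hk : ∀ c : k, algebraMap k K c ∈ O) (hA : A.FG) (hfr : IsFractionRing ↥A K)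
    (hAO : A.toSubring ≤ O.toSubring) (htr : Algebra.trdeg k K = 2) [IsIntegrallyClosed ↥A]
    (hsing : ¬ IsRegularLocalRing ↥(tower O A 0)) :
    IsNoetherianRing ↥(tower O A 0) ∧ IsIntegrallyClosed ↥(tower O A 0) ∧
      IsFractionRing ↥(tower O A 0) K ∧
      ∃ _ : IsLocalRing ↥(tower O A 0),
        ringKrullDim ↥(tower O A 0) = 2 ∧ Algebra.EssFiniteType k ↥(tower O A 0) := by
  haveI := hfr
  haveI : IsNoetherianRing ↥(tower O A 0) := stub_towerNoetherian k K O A hk hA hfr hAO _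
  haveI : IsLocalRing ↥(tower O A 0) := by
    rw [tower_zero, loc_eq_locAt]; exact SyzygyFlattening.isLocalRing_locAt O A hAO
  haveI : IsIntegrallyClosed ↥(tower O A 0) := by
    rw [tower_zero, loc_eq_locAt]; exact SyzygyFlattening.isIntegrallyClosed_locAt O A hAO
  have hfrT : IsFractionRing ↥(tower O A 0) K :=
    isFractionRing_subalgebra_of_le A (tower O A 0) (tn_tower_invariant O A hk hA hfr hAO 0).1
  have hdimT : ringKrullDim ↥(tower O A 0) = 2 := by
    refine ringKrullDim_eq_two_of_not_le_one (d2rc_ringKrullDim_tower_le O A 0 htr.le) ?_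
    intro h1
    exact hsing (Literature.AlgebraicGeometry.Resolution.isRegularLocalRing_of_isIntegrallyClosed_of_ringKrullDim_le_one _ h1)
  exact ⟨inferInstance, inferInstance, hfrT, inferInstance, hdimT,
    (tn_tower_invariant O A hk hA hfr hAO 0).2.2⟩

/-- **Rationality propagates from the birth stage** (modulo Lipman (1.2)): for `A` integrally closed
with `tr.deg_k K = 2`, if the birth stage `T₀ = A_𝔭` has a rational singularity then so has `T₁`
(regular `T₀`: the tower is stationary; regular `T₁`: rational outright; otherwise the pair lemma
`hasRationalSingularity_of_le` with `R := T₀`). [cite: Lipman1969, Proposition (1.2) 1) (p. 199)] -/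
theorem hasRationalSingularity_tower_one (h12 : Lipman1969_1_2.{0}) (O : ValuationSubring K)
    (A : Subalgebra k K) (hk : ∀ c : k, algebraMap k K c ∈ O) (hA : A.FG)
    (hfr : IsFractionRing ↥A K) (hAO : A.toSubring ≤ O.toSubring) (htr : Algebra.trdeg k K = 2)
    [IsIntegrallyClosed ↥A] (hrat : HasRationalSingularity ↥(tower O A 0)) :
    HasRationalSingularity ↥(tower O A (0 + 1)) := by
  by_cases hreg0 : IsRegularLocalRing ↥(tower O A 0)
  · rw [tower_succ_eq_self_of_isRegularLocalRing O A hk hfr hAO 0 hreg0]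
    exact hrat
  by_cases hreg1 : IsRegularLocalRing ↥(tower O A (0 + 1))
  · haveI := hreg1
    exact hasRationalSingularity_of_isRegularLocalRing _
  obtain ⟨hRnoeth, hRnorm, hRfr, hRloc, hdimR, -⟩ :=
    stage_package_zero_of_isIntegrallyClosed O A hk hA hfr hAO htr hreg0
  obtain ⟨hTnoeth, hTnorm, _, hTloc, hdimT, hTeft⟩ :=
    stage_package_of_trdeg O A hk hA hfr hAO htr 0 hreg1
  haveI := hRnoeth; haveI := hRnorm; haveI := hRfr; haveI := hRloc
  haveI := hTnoeth; haveI := hTnorm; haveI := hTloc; haveI := hTeft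
  have hRT : tower O A 0 ≤ tower O A (0 + 1) := fun y hy =>
    d2rc_mem_tower_of_le O A (Nat.le_succ 0) hy
  exact hasRationalSingularity_of_le h12 (tower O A 0) (tower O A (0 + 1)) hRT hdimR hrat hdimT

/-- **Every stage above a rational normal germ is rational** (modulo Lipman (1.2)): for `A` integrally
closed, `tr.deg_k K = 2`, and `T₀ = A_𝔭` with a rational singularity, every stage `T_m` of the
canonical `ca`-tower along `O` has a rational singularity.  This is the hypothesis form in which the
K-internal descent (`DescentSketch.RationalStageTermination`, hypothesis at a stage `T_(m₁+1)`) applies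
to a RATIONAL SURFACE SINGULARITY `A_𝔭` itself. [cite: Lipman1969, Proposition (1.2) 1) (p. 199)] -/
theorem hasRationalSingularity_tower_of_zero (h12 : Lipman1969_1_2.{0}) (O : ValuationSubring K)
    (A : Subalgebra k K) (hk : ∀ c : k, algebraMap k K c ∈ O) (hA : A.FG)
    (hfr : IsFractionRing ↥A K) (hAO : A.toSubring ≤ O.toSubring) (htr : Algebra.trdeg k K = 2)
    [IsIntegrallyClosed ↥A] (hrat : HasRationalSingularity ↥(tower O A 0)) (m : ℕ) :
    HasRationalSingularity ↥(tower O A m) := by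
  cases m with
  | zero => exact hrat
  | succ j =>
    exact hasRationalSingularity_tower_of_le h12 O A hk hA hfr hAO htr 0
      (hasRationalSingularity_tower_one h12 O A hk hA hfr hAO htr hrat) (j + 1) (by omega)

end Summit.ResolutionOfSingularities.ResolutionOfSingularities.Theorems.SurfaceTermination.RationalDescent

end
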